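import Summits.QuantumFields.BalabanUV.T4Continuum.Support.SmoothRefineOfApprox
import HarnessLib

/-!
# T⁴ programme, node NE3 — THE ACTION SANDWICH with EXISTENTIAL minimiser hypotheses: one REGULAR minimiser per
# level suffices (the form B11 Theorem 1 actually prints)

NE3 prover lineage P1, gen 17 (cell `pub-balaban`, unit `b2b-balaban-t4-ne3-p1`, row NE3 OWNER).  Answer to the
dictionary seat's finding (crew leaf-06, journal 2026-08-20T07:27:58Z): `SandwichData.regular` ∕ the (H3ˢᵘᵖ) binder of
`actionRate_sfClass_of_smoothRefine` ask that EVERY minimiser of a run be regular, whereas [Balaban1985Variational]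
Thm 1 p. 279 (with the abstract's «there exists a minimum of this action … unique up to gauge transformations») gives
ONE minimal orbit lying in the space (8) — i.e. the EXISTENCE of a regular minimiser, not the regularity of all
minimisers of a closed class (boundary minimisers of the closed small-field class are not excluded by anything printed).
The sandwich never needed more: its per-level bound uses ONE minimiser of run `k` and ONE of run `k+1`.  This file
re-derives the per-level bound and the `ActionRate` END from the EXISTENTIAL hypothesis
  (H∃) `∀ k, ∃ U, IsMinimiser d 𝒞 L N k V U ∧ RegularSup d L N b c k U`
(at `k = 0` the minimiser is `V` itself, so (H∃) contains the datum's level-0 regularity), the kinematic shape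
`SmoothRefine` (or `ApproxRefine` via `smoothRefine_of_approxRefine`), and class transport (a theorem for `sfClass`):
**`abs_minAct_sub_le_rate_of_exists`**, **`actionRate_of_exists`**, **`actionRate_sfClass_of_exists_approxRefine`**.
With the class radius `ε` STRICTLY larger than the minimisers' radius `b` (room for B7 Prop. 1's second-order loss,
`b + 226(8(d+1)(d+4))²b² ≤ ε`, and for the refinement's radius, `b₁ + 8mL³/g ≤ ε`) every hypothesis is of the printed
type: «a minimiser of run k over the class of radius ε₀η² exists and lies in the smaller space (8) (radius B₃ε₁η²,
regularity (9))» — ε₀ versus B₃ε₁ is exactly Thm 1's pair of radii.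

HONEST FRAMING.  Bookkeeping over landed modules; **NE3 is NOT proved** ((H∃) is a B11-Theorem-1-TYPE hypothesis
shape — its identification with the printed minimal orbit of the OPEN space (6) uses «inf over the closure = inf over
the interior» for the continuous action, a dictionary matter recorded by the crew's DIVERGENCE entries D-s3-*; and
`ApproxRefine` is the crew's open kinematic leaf).  No conditional of the cell used or hidden; finite T⁴ rung (B)+1;
NOT infinite volume, NOT mass gap, NOT Clay.  No `sorry`, no axioms beyond Mathlib's.
-/

set_option autoImplicit false

open scoped BigOperators Matrix Matrix.Norms.L2Operator
open NormedSpace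

namespace Summit.QuantumFields.BalabanUV.T4Continuum.MinimalActionRateExists

open Literature.MathematicalPhysics.QuantumFieldTheory.Balaban1983to89
open B7Prop1Explicit B7Prop2Explicit
open T4AveragingDeficitWall hiding Site Plane Plaq Bond
open T4AveragingDeficitWallBoundary (IsPeriodicCfg periodBox)
open T4AveragingDeficitNonAbelian (wallConstNA wallConstNA_nonneg)
open T4EtaRateMin (Readings ActionRate)
open MinimalActionLevels MinimalActionSandwich MinimalActionRate MinimalActionRefine SmoothRefineOfApprox ChainEndFix

noncomputable section

variable {d : ℕ} {n : Type*} [Fintype n] [DecidableEq n] [Nonempty n]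

/-- **THE PER-LEVEL RATE BOUND FROM ONE REGULAR MINIMISER PER LEVEL**: given a minimiser `UA` of run `k` and a
minimiser `UB` of run `k+1`, both with sup-form regularity `(b, c)`, class transport of `UB`'s average, and the kinematic
shape `SmoothRefine 𝒞 L N b c b′ c′`:
`|A_k(V) − A_{k+1}(V)| ≤ [wallConstNA(d,L)(gradConst d (max c c′) + (max b b′)³)/L²]·(L⁻²)^k·N^d`. [folklore] -/
theorem abs_minAct_sub_le_rate_of_exists {𝒞 : ℕ → Set (Site d → Fin d → (Matrix n n ℂ)ˣ)} {L N : ℕ} (hL : 1 ≤ L)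
    (hN : 1 ≤ N) {b c b' c' : ℝ} (hb0 : 0 ≤ b)
    (hbs : 512 * (d + 1) * (d + 4) * (L : ℝ) ^ 2 * max b b' ≤ 1)
    {V : Site d → Fin d → (Matrix n n ℂ)ˣ} {k : ℕ} {UA UB : Site d → Fin d → (Matrix n n ℂ)ˣ}
    (hA : IsMinimiser d 𝒞 L N k V UA) (hAreg : RegularSup d L N b c k UA)
    (hB : IsMinimiser d 𝒞 L N (k + 1) V UB) (hBreg' : RegularSup d L N b c (k + 1) UB)
    (hW : rescale L (bavg L UB) ∈ 𝒞 k) (hR : SmoothRefine d 𝒞 L N b c b' c') :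
    |minAct d 𝒞 L N k V - minAct d 𝒞 L N (k + 1) V|
      ≤ wallConstNA d L * (gradConst d (max c c') + (max b b') ^ 3) / (L : ℝ) ^ 2 * (((L : ℝ) ^ 2)⁻¹) ^ k
        * (N : ℝ) ^ d := by
  obtain ⟨Ut, hUt𝒞, havg, hTreg'⟩ := hR k UA hA.mem.1 hAreg
  -- both competitors with ONE pair of constants `(max b b′, gradConst d (max c c′))`
  have hBreg : Regular d L N (max b b') (gradConst d (max c c')) (k + 1) UB :=
    (hBreg'.mono (le_max_left _ _) (le_max_left _ _)).regular
  have hTreg : Regular d L N (max b b') (gradConst d (max c c')) (k + 1) Ut :=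
    (hTreg'.mono (le_max_right _ _) (le_max_right _ _)).regular
  -- from here on the letters of `MinimalActionRate.abs_minAct_sub_le_rate`
  have hb : 0 ≤ max b b' := le_max_of_le_left hb0
  set g : ℝ := gradConst d (max c c') with hgdef
  clear_value g
  revert hbs hb hBreg hTreg
  generalize max b b' = b
  intro hbs hb hBreg hTreg
  -- the common scale `s = L^{k+1} ≥ 1`
  have hL0 : (0 : ℝ) < L := by exact_mod_cast (by omega : 0 < L)
  have hL1 : (1 : ℝ) ≤ L := by exact_mod_cast hL
  set s : ℝ := (L : ℝ) ^ (k + 1) with hsdef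
  have hs1 : 1 ≤ s := one_le_pow₀ hL1
  have hs0 : 0 < s := by linarith
  have hs2 : 1 ≤ s ^ 2 := one_le_pow₀ hs1
  -- the common small-field radius `a = b/s²` and its threshold
  set a : ℝ := b / s ^ 2 with hadef
  have ha : 0 ≤ a := div_nonneg hb (by positivity)
  have hab : a ≤ b := div_le_self hb hs2
  have hsmall : 512 * (d + 1) * (d + 4) * (L : ℝ) ^ 2 * a ≤ 1 := by
    have hc : 0 ≤ 512 * ((d : ℝ) + 1) * (d + 4) * (L : ℝ) ^ 2 := by positivity
    nlinarith
  -- the common gradient bound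
  set G : ℝ := g * (N : ℝ) ^ d * s ^ d / s ^ 6 with hGdef
  have hmain := abs_minAct_sub_minAct_le_wall hL hN hA hB hW hUt𝒞 havg hBreg.unitary hBreg.periodic hTreg.unitary
    hTreg.periodic ha hsmall hBreg.small hTreg.small hBreg.grad hTreg.grad
  -- `a³ (N L^k)^d ≤ b³ N^d s^d / s^6`
  have hNr : (0 : ℝ) ≤ (N : ℝ) ^ d := by positivity
  have hM : ((N * L ^ k : ℕ) : ℝ) ^ d ≤ (N : ℝ) ^ d * s ^ d := by
    push_cast
    rw [mul_pow]
    refine mul_le_mul_of_nonneg_left ?_ hNr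
    exact pow_le_pow_left₀ (by positivity) (pow_le_pow_right₀ hL1 (Nat.le_succ k)) d
  have ha3 : a ^ 3 * ((N * L ^ k : ℕ) : ℝ) ^ d ≤ b ^ 3 * (N : ℝ) ^ d * s ^ d / s ^ 6 := by
    have h1 : a ^ 3 = b ^ 3 / s ^ 6 := by rw [hadef, div_pow, ← pow_mul]
    rw [h1, div_mul_eq_mul_div, mul_assoc]
    exact div_le_div_of_nonneg_right (mul_le_mul_of_nonneg_left hM (pow_nonneg hb 3)) (by positivity)
  have hsum : G + a ^ 3 * ((N * L ^ k : ℕ) : ℝ) ^ d ≤ (g + b ^ 3) * (N : ℝ) ^ d * s ^ d / s ^ 6 := by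
    have : (g + b ^ 3) * (N : ℝ) ^ d * s ^ d / s ^ 6 = G + b ^ 3 * (N : ℝ) ^ d * s ^ d / s ^ 6 := by
      rw [hGdef]; ring
    rw [this]; linarith
  have hWc := wallConstNA_nonneg (d := d) L
  have hc : 0 ≤ ((stepWt d L)⁻¹) ^ (k + 1) := pow_nonneg (inv_nonneg.mpr (stepWt_pos (d := d) L hL).le) _
  have hstep : ((stepWt d L)⁻¹) ^ (k + 1) * (wallConstNA d L * (G + a ^ 3 * ((N * L ^ k : ℕ) : ℝ) ^ d))
      ≤ ((stepWt d L)⁻¹) ^ (k + 1) * (wallConstNA d L * ((g + b ^ 3) * (N : ℝ) ^ d * s ^ d / s ^ 6)) :=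
    mul_le_mul_of_nonneg_left (mul_le_mul_of_nonneg_left hsum hWc) hc
  refine (hmain.trans hstep).trans (le_of_eq ?_)
  rw [stepWt_inv_eq (d := d) L hL, hsdef]
  exact rate_algebra hL0.ne' k

/-- **NE3, ACTION HALF, FROM ONE REGULAR MINIMISER PER LEVEL** (general class family): if for every datum of `dom`
and every level `k` SOME minimiser of run `k` exists with sup-form regularity `(b, c)` (at `k = 0` this is the datum's
own regularity), the averaged such minimisers stay in the class, and the kinematic shape `SmoothRefine` holds, then
`ActionRate (minActReadings 𝒞 L N dom loc) (wallConstNA(d,L)(gradConst d (max c c′) + (max b b′)³)/L²) (L⁻²)`.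
[folklore] -/
theorem actionRate_of_exists {𝒞 : ℕ → Set (Site d → Fin d → (Matrix n n ℂ)ˣ)} {L N : ℕ} (hL : 1 ≤ L) (hN : 1 ≤ N)
    {b c b' c' : ℝ} (hb0 : 0 ≤ b) (hbs : 512 * (d + 1) * (d + 4) * (L : ℝ) ^ 2 * max b b' ≤ 1)
    {dom : Set (Site d → Fin d → (Matrix n n ℂ)ˣ)}
    (hmin : ∀ V ∈ dom, ∀ k : ℕ, ∃ U, IsMinimiser d 𝒞 L N k V U ∧ RegularSup d L N b c k U)
    (h4 : ∀ V ∈ dom, ∀ (k : ℕ) (U : Site d → Fin d → (Matrix n n ℂ)ˣ),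
      IsMinimiser d 𝒞 L N (k + 1) V U → RegularSup d L N b c (k + 1) U → rescale L (bavg L U) ∈ 𝒞 k)
    (hR : SmoothRefine d 𝒞 L N b c b' c') {X : Type*} (loc : ℕ → (Site d → Fin d → (Matrix n n ℂ)ˣ) → X → ℝ) :
    ActionRate (minActReadings d 𝒞 L N dom loc)
      (wallConstNA d L * (gradConst d (max c c') + (max b b') ^ 3) / (L : ℝ) ^ 2) (((L : ℝ) ^ 2)⁻¹) := by
  intro k V hV
  show |minAct d 𝒞 L N (k + 1) V - minAct d 𝒞 L N k V|
    ≤ wallConstNA d L * (gradConst d (max c c') + (max b b') ^ 3) / (L : ℝ) ^ 2 * (((L : ℝ) ^ 2)⁻¹) ^ k * (N : ℝ) ^ d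
  rw [abs_sub_comm]
  obtain ⟨UA, hA, hAreg⟩ := hmin V hV k
  obtain ⟨UB, hB, hBreg⟩ := hmin V hV (k + 1)
  exact abs_minAct_sub_le_rate_of_exists hL hN hb0 hbs hA hAreg hB hBreg (h4 V hV k UB hB hBreg) hR

/-- **NE3, ACTION HALF, FOR THE SMALL-FIELD CLASS, FROM ONE REGULAR MINIMISER PER LEVEL AND THE APPROXIMATE
REFINEMENT** — the form B11 Theorem 1 prints («a minimal orbit exists in the space (8)»): hypotheses (H∃)
`∀ V ∈ dom, ∀ k, ∃ U, IsMinimiser d (sfClass d L N ε) L N k V U ∧ RegularSup d L N b c k U` (ONE regular minimiser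
per level; no claim about other minimisers) and `ApproxRefine d (sfClass d L N ε) L N b c b₁ c₁ m` (leaf R1), with the
class radius `ε` leaving room for both B7 Prop. 1's loss (`hbε`) and the refinement's radius (`hε`). [folklore] -/
theorem actionRate_sfClass_of_exists_approxRefine {L N : ℕ} (hL : 1 ≤ L) (hN : 1 ≤ N) {b c b₁ c₁ m ε : ℝ}
    (hb : 0 ≤ b) (hb₁ : 0 ≤ b₁) (hm : 0 ≤ m)
    (hBs : 512 * (d + 1) * (d + 4) * (L : ℝ) ^ 2 * max b (b₁ + 8 * m * (L : ℝ) ^ 3 / gap d L) ≤ 1)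
    (hbε : b + 226 * (8 * (d + 1) * (d + 4)) ^ 2 * b ^ 2 ≤ ε)
    (hbs₁ : 512 * (d + 1) * (d + 4) * (L : ℝ) ^ 2 * b₁ ≤ 1)
    (hgap : 4 * (2 * (8 * (d + 1) * (d + 4) * (L : ℝ) ^ 2 * b₁) + 2 * m / gap d L) ≤ gap d L)
    (hhalf : b₁ + 8 * m / gap d L ≤ 1 / 2) (hε : b₁ + 8 * m * (L : ℝ) ^ 3 / gap d L ≤ ε)
    {dom : Set (Site d → Fin d → (Matrix n n ℂ)ˣ)}
    (hmin : ∀ V ∈ dom, ∀ k : ℕ, ∃ U, IsMinimiser d (sfClass d L N ε) L N k V U ∧ RegularSup d L N b c k U)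
    (hA : ApproxRefine d (sfClass (n := n) d L N ε) L N b c b₁ c₁ m)
    {X : Type*} (loc : ℕ → (Site d → Fin d → (Matrix n n ℂ)ˣ) → X → ℝ) :
    ActionRate (minActReadings d (sfClass d L N ε) L N dom loc)
      (wallConstNA d L * (gradConst d (max c (c₁ + 36 * m * (L : ℝ) ^ 3 / gap d L))
        + (max b (b₁ + 8 * m * (L : ℝ) ^ 3 / gap d L)) ^ 3) / (L : ℝ) ^ 2) (((L : ℝ) ^ 2)⁻¹) := by
  have hbs : 512 * (d + 1) * (d + 4) * (L : ℝ) ^ 2 * b ≤ 1 := by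
    have h0 : (0 : ℝ) ≤ 512 * (d + 1) * (d + 4) * (L : ℝ) ^ 2 := by positivity
    exact (mul_le_mul_of_nonneg_left (le_max_left _ _) h0).trans hBs
  refine actionRate_of_exists hL hN hb hBs hmin (fun V _ k U _ hreg => ?_)
    (smoothRefine_of_approxRefine hL hb₁ hm hbs₁ hgap hhalf hε hA) loc
  exact rescale_bavg_mem_sfClass hL hb hbs hbε hreg.regular

end

end Summit.QuantumFields.BalabanUV.T4Continuum.MinimalActionRateExists
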